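import Literature.Probability.Percolation.QuadCrossingExplorationRegion
import Literature.Probability.Percolation.QuadCrossingSeparatorArmOff
import Literature.Probability.Percolation.LowestCrossingDecoupling
import Literature.Probability.Percolation.FiniteEnergy
import Literature.Probability.Percolation.QuadCrossingRawClosed
import Literature.Probability.Percolation.QuadCrossingSubquadTopology
import Literature.Probability.Percolation.AnnulusCrossingBoundProofs
import HarnessLib

/-!
# Schramm–Smirnov Lemma 6.1, case (2), tame quads: decoupling over the lowest crossing and the estimate

## Part: QuadCrossingExplorationDecoupling

# Decoupling over the lowest crossing: `P(⊞_{Q'} ∖ ⊞_Q, x far from ∂₃Q) ≤ sup_x P(closed arm at x)`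

Topic `Probability/Percolation`; proofs file towards the named fact `SchrammSmirnov2011_lemma_6_1`
(`QuadCrossingContinuity.lean`; O. Schramm, S. Smirnov, *On the scaling limits of planar
percolation*, Ann. Probab. 39 (2011), arXiv:1101.5820, proof of Lemma 6.1, case (2), eq. (6.2):
"We now estimate `P(¬⊞_Q | ⊞_{Q'}, γ, x ∈ σ₃)` … there is a dual closed crossing … crossing the
annulus `A(x, δ, d₁/2)` inside `[Q] ∖ M`.  The lowest crossing `γ` depends only on the configuration
inside `M`, so the restriction of `ω` to `[Q] ∖ M` is unbiased.  Therefore, the conditional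
probability of the mentioned annulus crossing … can be bound by the RSW estimate").

`Frame.Charts.measureReal_crossed_not_crossed_far_le` assembles the tree's pieces into the
probability estimate, for critical bond percolation on `δℤ²` and a pair of quads as in condition
(2) (`[Q'] ⊆ [Q]`, `∂₀Q' = ∂₀Q`, `∂₁Q' ⊆ ∂₁Q`, short junctions of `∂₂Q'` to `∂₂Q`), under the two
tameness hypotheses isolated by the freshness analysis — the larger quad meets every drawn edge
segment in a preconnected set (`htame`), and two points of the free side `∂₂Q'` at distance `≤ ρ`
span a sub-arc within `K ρ` (`harc`) — which hold for the piecewise smooth quads of the applications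
and are assumptions for general ones: with the frame `Φ` charting `Q'`, `x(ω) = G(wallPt ω)` the
endpoint of the lowest crossing,

`P_{1/2}(Q' crossed ∧ Q not crossed ∧ every junction of x(ω) to ∂₃Q has diameter ≥ c₃)`
`≤ sup_x P_{1/2}(A(x; r, c₃/2 - 2δ) has a closed dual crossing)` for any `r ≥ Kρ + 5δ`.

Ingredients: the lowest crossing and its endpoint (`QuadLowestCrossingDefs/Proofs.lean`,
`QuadCrossingExplorationCharts.lean`); the exit set (`QuadCrossingExplorationExitSet.lean`); freshness of
the upper region and the no-leak corollary (`QuadCrossingExplorationFresh.lean`); the fresh closed arm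
(`QuadCrossingSeparatorArmOff.lean`, `QuadCrossingFreshArms.lean`); determination of `{Λ = Λ₀}` by the
revealed edges, independence of events on disjoint edge sets (`bondPercolation_inter_of_disjoint`),
and "conditioning without conditioning" (`measure_le_mul_of_forall_inter_eq_mul`).  Everything is
proved; no named fact is introduced.

## References

* O. Schramm, S. Smirnov, Ann. Probab. 39 (2011) 1768–1814, arXiv:1101.5820, proof of Lemma 6.1,
  case (2), eq. (6.2). [SchrammSmirnov2011]
* G. Grimmett, *Percolation*, 2nd ed. (1999), §2.2, §11.8. [GrimmettPercolation1999]

## Part: QuadCrossingContinuityCaseTwoTame_src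

# Schramm–Smirnov Lemma 6.1, case (2), main sub-case, for tame quads

Topic `Probability/Percolation`; proofs file towards the named fact `SchrammSmirnov2011_lemma_6_1`
(`QuadCrossingContinuity.lean`; O. Schramm, S. Smirnov, *On the scaling limits of planar
percolation*, Ann. Probab. 39 (2011), arXiv:1101.5820, Lemma 6.1 and its proof, pp. 21–23).

`real_symmDiff_crossedEvent_le_of_isPerturbationTwo_of_tame` is the estimate of case (2) of
Lemma 6.1 in its main sub-case `d = d₁` — `P(⊞_Q Δ ⊞_{Q'}) ≤ 2 (C K ρ / d₁(Q))^α` for critical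
bond percolation of every mesh `η < ρ` (and `measureReal_symmDiff_le_mul_of_isPerturbationTwo_of_tame`
is its product form `≤ 2 (C K ρ / d₁(Q))^α · P(⊞_{Q'})` at the level of `P_{1/2}`, the printed
"total expectation" shape used for sub-case (iii)) — following the printed proof (lowest crossing `γ`, its
endpoint `x` on `∂₂Q'`, a closed dual arm about `x` in the unexplored region, RSW; "the other
case being symmetric" via the flipped quads and the uppermost crossing), for pairs `(Q, Q')`
satisfying condition (2) **and four tameness hypotheses** under which the printed argument is
complete (see `QuadCrossingExplorationFresh.lean` for why some restriction is needed):

* `htame` — the larger quad meets every drawn edge segment in a preconnected set (no sub-mesh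
  fjords: closed revealed edges do not leak out of the explored region);
* `harc` — two points of the free side `∂₂Q'` at distance `≤ ρ` span a sub-arc within `K ρ`;
* `hstar` — `[Q']` is locally star-shaped at every point of `∂₂Q'` (access to landing points,
  whence the lowest crossing lands below the uppermost one, `QuadCrossingNoInversion.lean`);
* `hcut` — Schramm–Smirnov's cut point `z`: a parameter `ζ` such that points `Q'(1,t)`, `t ≤ ζ`,
  have all junctions to `∂₃Q` of diameter `≥ d₁/4`, and points with `t ≥ ζ` all junctions to
  `∂₁Q` of diameter `≥ d₁/4`.

Polygonal and piecewise-smooth quads, the ones met in the applications of Lemma 6.1, satisfy all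
four for small `ρ`.  Everything here is proved; the named fact itself (all quads) is not discharged
by this file.

## References

* O. Schramm, S. Smirnov, Ann. Probab. 39 (2011) 1768–1814, arXiv:1101.5820, Lemma 6.1.
  [SchrammSmirnov2011]
* G. Grimmett, *Percolation*, 2nd ed. (1999), §11.7–11.8 (RSW at `p = 1/2`). [GrimmettPercolation1999]
-/

noncomputable section

/-! ## Part `QuadCrossingExplorationDecoupling` -/

section
open Set Metric Filter Function
open _root_.MeasureTheory _root_.Topology
open scoped ENNReal
open Literature.Probability.LatticeModels
open Literature.Topology.PlaneTopology

namespace Literature.Probability.Percolation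

namespace QuadCrossing

namespace Quad

variable {D : Set ℂ}

/-- **Every quad is charted by the standard frame** (`Quad.exists_frame_charts` with the chart
formula on the right side kept). [cite: SchrammSmirnov2011, proof of Lemma 6.1] -/
theorem exists_frame_charts' (Q : Quad D) {δ : ℝ} (hδ : 0 < δ) :
    ∃ Φ : SSContinuity.Frame, Φ.Charts Q ∧ Φ.δ = δ ∧ Φ.a = -1 ∧ Φ.b = 1 ∧ Φ.c = -1 ∧ Φ.d = 1 ∧
      ∀ t : unitInterval, Φ.G ⟨1, 2 * (t : ℝ) - 1⟩ = Q (1, t) := by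
  obtain ⟨H, hsymm, hcar, h0, h1, h2, h3⟩ := Q.exists_straighten
  refine ⟨⟨H, -1, 1, -1, 1, 1, δ, 1, by norm_num, by norm_num, by norm_num, hδ, by norm_num⟩,
    ⟨hcar, h0, h1, h2, h3⟩, rfl, rfl, rfl, rfl, rfl, fun t => ?_⟩
  have := hsymm (1, t)
  rw [Homeomorph.symm_apply_eq] at this
  rw [this]
  congr 1
  apply Complex.ext
  · simp; norm_num
  · simp

/-- The tail of a path from parameter `s`, as a path. [folklore] -/
def tailPath {x y : ℂ} (α : Path x y) (s : unitInterval) : Path (α s) y where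
  toFun t := α.extend ((s : ℝ) + (t : ℝ) * (1 - s))
  continuous_toFun := α.continuous_extend.comp (by fun_prop)
  source' := by simp
  target' := by simp

/-- Its range lies in the range of the path. [folklore] -/
theorem range_tailPath {x y : ℂ} (α : Path x y) (s : unitInterval) : range (tailPath α s) ⊆ range α := by
  rintro _ ⟨t, rfl⟩
  exact ⟨projIcc 0 1 zero_le_one _, rfl⟩

end Quad

end QuadCrossing

namespace SSContinuity

namespace Frame

variable (Φ : Frame) {D : Set ℂ} {Q Q' : QuadCrossing.Quad D}

/-- A frontier crossing of `Λ(ω)` is a frontier crossing for every configuration with the same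
explored region. [cite: SchrammSmirnov2011, proof of Lemma 6.1] -/
theorem isFrontierCrossing_of_explored_eq {ω ω' : BondConfig (Site 2)} {Γ : Set ℂ}
    (hΓ : Φ.IsFrontierCrossing ω Γ) (h : Φ.explored ω' = Φ.explored ω) : Φ.IsFrontierCrossing ω' Γ := by
  have hfs : Φ.frontierSet ω' = Φ.frontierSet ω := by simp only [frontierSet, h]
  exact ⟨hfs ▸ hΓ.1, hΓ.2⟩

/-- The image of a frontier crossing lies in the open edges (no chart data needed).
[cite: SchrammSmirnov2011, proof of Lemma 6.1] -/
theorem image_subset_openEdgeUnion_of_isFrontierCrossing {ω : BondConfig (Site 2)} {Γ : Set ℂ}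
    (hΓ : Φ.IsFrontierCrossing ω Γ) : Φ.G '' Γ ⊆ openEdgeUnion Φ.δ ω := by
  have hobs := hΓ.subset_obstacle
  obtain ⟨-, -, hΓconn, ⟨za, hza, hzare⟩, ⟨zb, hzb, hzbre⟩⟩ := hΓ
  have hdrawn : Φ.G '' Γ ⊆ openEdgeUnion Φ.δ ω ∪ range (meshPoint Φ.δ) := by
    rintro _ ⟨u, hu, rfl⟩
    exact (hobs hu).2
  have hne : Φ.G za ≠ Φ.G zb := fun h' => by
    have := Φ.G.injective h'
    rw [← this] at hzbre
    linarith [Φ.hab, hzare, hzbre]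
  exact subset_closure.trans (QuadCrossing.closure_subset_openEdgeUnion_of_isPreconnected Φ.hδ
    ((hΓconn.image _ Φ.G.continuous.continuousOn).isPreconnected) hdrawn
    (mem_image_of_mem _ hza) (mem_image_of_mem _ hzb) hne)

/-- A frontier crossing witnesses `Crossed`. [cite: SchrammSmirnov2011, proof of Lemma 6.1] -/
theorem crossed_of_isFrontierCrossing {ω : BondConfig (Site 2)} {Γ : Set ℂ}
    (hΓ : Φ.IsFrontierCrossing ω Γ) : Φ.Crossed Φ.b ω := by
  have hO := Φ.image_subset_openEdgeUnion_of_isFrontierCrossing hΓ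
  exact ⟨Γ, hΓ.subset_rect, hΓ.2.1, hΓ.2.2.1, fun u hu => hO (mem_image_of_mem _ hu), hΓ.2.2.2.1,
    hΓ.2.2.2.2⟩

/-- **Being crossed depends only on the explored region.** [cite: SchrammSmirnov2011, proof of Lemma 6.1] -/
theorem crossed_of_explored_eq {ω ω' : BondConfig (Site 2)} (hcr : Φ.Crossed Φ.b ω)
    (h : Φ.explored ω' = Φ.explored ω) : Φ.Crossed Φ.b ω' := by
  obtain ⟨Γ, hΓ⟩ := Φ.exists_frontierCrossing hcr
  exact Φ.crossed_of_isFrontierCrossing (Φ.isFrontierCrossing_of_explored_eq hΓ h)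

variable {Φ} in
/-- A chart crossing gives a crossing of the charted quad inside the open edges.
[cite: SchrammSmirnov2011, §1.3] -/
theorem Charts.exists_isCrossing (hΦ : Φ.Charts Q') {ω : BondConfig (Site 2)} (hcr : Φ.Crossed Φ.b ω) :
    ∃ K, Q'.IsCrossing K ∧ K ⊆ openEdgeUnion Φ.δ ω := by
  obtain ⟨Γ, hΓ⟩ := Φ.exists_frontierCrossing hcr
  obtain ⟨hLO, hLQ', hLc, hLconn, hL0', hL2'⟩ := hΦ.image_isFrontierCrossing hΓ
  exact ⟨Φ.G '' Γ, ⟨hLc, hLconn, hLQ', hL0', hL2'⟩, hLO⟩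

variable {Φ} in
/-- **Decoupling over the lowest crossing** (see the module docstring).
[cite: SchrammSmirnov2011, proof of Lemma 6.1, case (2), eq. (6.2)] -/
theorem Charts.measureReal_crossed_not_crossed_far_le (hΦ : Φ.Charts Q') (hb : Φ.b = 1)
    (hc : Φ.c = -1) (hd : Φ.d = 1) (hG : ∀ t : unitInterval, Φ.G ⟨1, 2 * (t : ℝ) - 1⟩ = Q' (1, t))
    (hcar : Q'.carrier ⊆ Q.carrier) (h0 : Q'.side 0 = Q.side 0) (h1 : Q'.side 1 ⊆ Q.side 1)
    {ρ : ℝ} (hρ : 0 < ρ) (hρ0 : ρ < Q.sideDist 0)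
    (hjoin : ∀ x ∈ Q'.side 2, Q.ShortJoin ρ x (Q.side 2))
    (htame : ∀ a b : Site 2, (zdGraph 2).Adj a b →
      IsPreconnected (segment ℝ (meshPoint Φ.δ a) (meshPoint Φ.δ b) ∩ Q.carrier))
    {K : ℝ} (hK : 1 ≤ K)
    (harc : ∀ s t : unitInterval, dist (Q' (1, s)) (Q' (1, t)) ≤ ρ → ∀ u : unitInterval,
      ((s : ℝ) ≤ u ∧ (u : ℝ) ≤ t ∨ (t : ℝ) ≤ u ∧ (u : ℝ) ≤ s) → dist (Q' (1, u)) (Q' (1, s)) ≤ K * ρ)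
    {c₃ r : ℝ} (hr : K * ρ + 5 * Φ.δ ≤ r) (hrc : K * ρ + 5 * Φ.δ ≤ c₃ / 2) {η : ℝ} (hη0 : 0 ≤ η)
    (hη : ∀ x : ℂ, (bondPercolation (zdGraph 2) half).real
      (annulusDualCrossing x Φ.δ r (c₃ / 2 - 2 * Φ.δ)) ≤ η) :
    (bondPercolation (zdGraph 2) half).real
      {ω | (∃ K', Q'.IsCrossing K' ∧ K' ⊆ openEdgeUnion Φ.δ ω) ∧
        (¬ ∃ K, Q.IsCrossing K ∧ K ⊆ openEdgeUnion Φ.δ ω) ∧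
        ∀ t ∈ Q.side 3, ∀ p : Path (Φ.G (Φ.wallPt ω)) t, range p ⊆ Q.carrier →
          c₃ ≤ Metric.diam (range p)} ≤
      η * (bondPercolation (zdGraph 2) half).real
        {ω | ∃ K', Q'.IsCrossing K' ∧ K' ⊆ openEdgeUnion Φ.δ ω} := by
  set μ := bondPercolation (zdGraph 2) half with hμ
  set Ev : Set (BondConfig (Site 2)) := {ω | (∃ K', Q'.IsCrossing K' ∧ K' ⊆ openEdgeUnion Φ.δ ω) ∧
      (¬ ∃ K, Q.IsCrossing K ∧ K ⊆ openEdgeUnion Φ.δ ω) ∧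
      ∀ t ∈ Q.side 3, ∀ p : Path (Φ.G (Φ.wallPt ω)) t, range p ⊆ Q.carrier →
        c₃ ≤ Metric.diam (range p)} with hEv
  set B : Set (BondConfig (Site 2)) := {ω | ∃ K', Q'.IsCrossing K' ∧ K' ⊆ openEdgeUnion Φ.δ ω} with hB
  set 𝒟 : Set (Set ℂ) := {d | ∃ ω, Φ.explored ω = d ∧ Φ.Crossed Φ.b ω} with h𝒟
  have h𝒟c : 𝒟.Countable := (Φ.finite_range_explored.subset (by rintro d ⟨ω, hω, -⟩; exact ⟨ω, hω⟩)).countable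
  set A : Set ℂ → Set (BondConfig (Site 2)) := fun d => {ω | Φ.explored ω = d} with hA
  set F : Set ℂ → Set (BondConfig (Site 2)) := fun d =>
    annulusDualCrossingOff (Φ.revealedIn d) (Φ.armCentre d) Φ.δ r (c₃ / 2 - 2 * Φ.δ) with hF
  have hδ := Φ.hδ
  -- the key inclusion: on the event, the fresh closed arm about `x(Λ)` off the revealed edges
  have hkey : ∀ ω ∈ Ev, ω ∈ F (Φ.explored ω) := by
    rintro ω ⟨⟨K', hK', hK'O⟩, hnot, hfar⟩
    have hcr : Φ.Crossed Φ.b ω := hΦ.crossed hK' hK'O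
    obtain ⟨Γ, hΓ⟩ := Φ.exists_frontierCrossing hcr
    obtain ⟨hLO, hLQ', hLc, hLconn, hL0', -⟩ := hΦ.image_isFrontierCrossing hΓ
    have hxL : Φ.G (Φ.wallPt ω) ∈ Φ.G '' Γ := Φ.image_wallPt_mem hcr hΓ
    have hx2 : Φ.G (Φ.wallPt ω) ∈ Q'.side 2 := hΦ.image_wallPt_mem_side_two hcr
    -- the short junction at `x`
    obtain ⟨y₂, hy₂, α, hαQ, hαdiam⟩ := hjoin _ hx2
    have hαx : ∀ s, dist (α s) (Φ.G (Φ.wallPt ω)) ≤ ρ := fun s =>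
      (dist_le_diam_of_mem (isCompact_range α.continuous).isBounded ⟨s, rfl⟩ ⟨0, α.source⟩).trans hαdiam
    have hα0 : ∀ s, α s ∉ Q'.side 0 := fun s hs => by
      rw [h0] at hs
      have := QuadCrossing.Quad.sideDist_le hs hy₂ (QuadCrossing.Quad.tailPath α s)
        ((QuadCrossing.Quad.range_tailPath α s).trans hαQ)
      have hle : Metric.diam (range (QuadCrossing.Quad.tailPath α s)) ≤ ρ :=
        (diam_mono (QuadCrossing.Quad.range_tailPath α s) (isCompact_range α.continuous).isBounded).trans hαdiam
      linarith
    -- the exit set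
    obtain ⟨E, m, hEc, hEpc, hEQ, hxE, hE2, hEjoin, hAE, hEm, hE0⟩ :=
      hΦ.exists_exitSet hb hc hd hG hcr hρ.le hK harc hcar hy₂ α hαQ hαx hα0
    have hWpc : IsPreconnected (Φ.G '' Γ ∪ E) :=
      IsPreconnected.union _ hxL hxE hLconn.isPreconnected hEpc
    -- the fresh closed arm
    have harm := QuadCrossing.Quad.mem_annulusDualCrossingOff_of_not_exists_isCrossing hδ hLc hLconn
      (hLQ'.trans hcar) hLO (by rw [← h0]; exact hL0') hxL hfar (by positivity : (0 : ℝ) ≤ K * ρ) hEc hEpc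
      hEQ hxE hE2 hEjoin (show K * ρ < K * ρ + 3 * Φ.δ by linarith)
      (show K * ρ + 3 * Φ.δ + 2 * Φ.δ ≤ c₃ / 2 by linarith) (S := Φ.revealedIn (Φ.explored ω))
      (fun a b hab hS hclosed q hqseg hqQ hqM => by
        rcases hΦ.mem_range_or_exists_mem_of_revealedIn hcar h0 h1 hΓ hEc hEQ hWpc hE2 hAE hEm hE0 htame
          hab hS hclosed hqseg hqQ hqM with hV | ⟨w, hwseg, hwE⟩
        · exact Or.inl hV
        · right
          obtain ⟨p, -, hp⟩ := hEjoin w hwE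
          have hwx : dist w (Φ.G (Φ.wallPt ω)) ≤ K * ρ := by simpa [p.target] using hp 1
          have hqa := dist_meshPoint_le_of_mem_segment hδ hab hqseg
          have hwa := dist_meshPoint_le_of_mem_segment hδ hab hwseg
          have hqw : dist q w ≤ 2 * Φ.δ := by
            linarith [dist_triangle q (meshPoint Φ.δ a) w, dist_comm (meshPoint Φ.δ a) q]
          linarith [dist_triangle q w (Φ.G (Φ.wallPt ω))])
      hnot
    -- enlarge the inner radius and identify the centre
    rw [mem_annulusDualCrossingOff_iff] at harm ⊢
    show ω ∪ Φ.revealedIn (Φ.explored ω) ∈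
      annulusDualCrossing (Φ.armCentre (Φ.explored ω)) Φ.δ r (c₃ / 2 - 2 * Φ.δ)
    rw [Φ.armCentre_explored]
    exact annulusDualCrossing_mono_left _ _ (by linarith) _ harm
  -- decoupling over the values of `Λ`
  have hEsub : Ev ⊆ ⋃ d ∈ 𝒟, A d ∩ F d := fun ω hω =>
    mem_iUnion₂.2 ⟨Φ.explored ω, ⟨ω, rfl, hΦ.crossed hω.1.choose_spec.1 hω.1.choose_spec.2⟩, rfl, hkey ω hω⟩
  have hUB : (⋃ d ∈ 𝒟, A d) ⊆ B := by
    intro ω' hω'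
    obtain ⟨d, hd, hω'd⟩ := mem_iUnion₂.1 hω'
    obtain ⟨ω, hωd, hcr⟩ := hd
    have : Φ.explored ω' = Φ.explored ω := (show Φ.explored ω' = d from hω'd).trans hωd.symm
    exact hΦ.exists_isCrossing (Φ.crossed_of_explored_eq hcr this)
  have hAmeas : ∀ d ∈ 𝒟, MeasurableSet (A d) := fun d _ => Φ.measurableSet_explored_eq d
  have hdisj : 𝒟.PairwiseDisjoint A := fun d _ d' _ hne =>
    disjoint_left.2 fun ω (h : Φ.explored ω = d) (h' : Φ.explored ω = d') => hne (h.symm.trans h')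
  have hprod : ∀ d ∈ 𝒟, μ (A d ∩ F d) = μ (A d) * μ (F d) := fun d hd =>
    bondPercolation_inter_of_disjoint _ _ disjoint_compl_right (Φ.determinedBy_explored_eq_revealedIn d)
      (determinedBy_annulusDualCrossingOff _ _ _ _ _) (hAmeas d hd)
      (measurableSet_annulusDualCrossingOff _ hδ _ _ _)
  have hFle : ∀ d ∈ 𝒟, μ (F d) ≤ ENNReal.ofReal η := fun d _ => by
    refine (measure_mono (annulusDualCrossingOff_subset _ _ _ _ _)).trans ?_
    rw [← ENNReal.ofReal_toReal (measure_ne_top μ _)]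
    exact ENNReal.ofReal_le_ofReal (hη _)
  have hbound := measure_le_mul_of_forall_inter_eq_mul μ h𝒟c hEsub hAmeas hdisj hprod hFle
  have hEv : μ Ev ≤ ENNReal.ofReal η * μ B := hbound.trans (by gcongr)
  show (μ Ev).toReal ≤ η * (μ B).toReal
  have := ENNReal.toReal_mono (ENNReal.mul_ne_top ENNReal.ofReal_ne_top (measure_ne_top μ B)) hEv
  rwa [ENNReal.toReal_mul, ENNReal.toReal_ofReal hη0] at this

end Frame

end SSContinuity

end Literature.Probability.Percolation

end

/-! ## Part `QuadCrossingContinuityCaseTwoTame_src` -/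

section
open Set Metric Filter Function
open _root_.MeasureTheory _root_.Topology
open scoped ENNReal
open Literature.Probability.LatticeModels

namespace Literature.Probability.Percolation

namespace QuadCrossing

variable {D : Set ℂ}

/-- **Schramm–Smirnov Lemma 6.1, case (2), sub-case `d = d₁`, tame quads — product form at the
level of `P_{1/2}`**: `P(⊞_Q Δ ⊞_{Q'}) ≤ 2 (C K ρ / d₁(Q))^α · P(⊞_{Q'})` for the discrete crossing
events of critical bond percolation of mesh `η` (edge length `η√2`), the factor `P(⊞_{Q'})` being the
printed "total expectation" form of the estimate (eq. (6.4): "`≤ 2 P(⊞_{Q'}) Δ₁(δ, d₁/2)`"), under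
the four tameness hypotheses of the module docstring.
[cite: SchrammSmirnov2011, Lemma 6.1 (2) and its proof, pp. 21–23, eq. (6.2)–(6.4)] -/
theorem measureReal_symmDiff_le_mul_of_isPerturbationTwo_of_tame :
    ∃ α C c : ℝ, 0 < α ∧ 0 < C ∧ 0 < c ∧
      ∀ (D : Set ℂ) (Q Q' : Quad D) (ρ K : ℝ), 0 < ρ → 1 ≤ K → K * ρ ≤ c * Q.sideDist 1 →
        ρ < Q.sideDist 0 → Q.IsPerturbationTwo Q' ρ →
        (∀ η : ℝ, 0 < η → η < ρ → ∀ a b : Site 2, (zdGraph 2).Adj a b →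
          IsPreconnected (segment ℝ (meshPoint (η * Real.sqrt 2) a) (meshPoint (η * Real.sqrt 2) b) ∩
            Q.carrier)) →
        (∀ s t : unitInterval, dist (Q' (1, s)) (Q' (1, t)) ≤ ρ → ∀ u : unitInterval,
          ((s : ℝ) ≤ u ∧ (u : ℝ) ≤ t ∨ (t : ℝ) ≤ u ∧ (u : ℝ) ≤ s) →
            dist (Q' (1, u)) (Q' (1, s)) ≤ K * ρ) →
        (∀ x ∈ Q'.side 2, ∃ r > 0, ∀ u ∈ Q'.carrier, u ∈ ball x r → segment ℝ x u ⊆ Q'.carrier) →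
        (∃ ζ : ℝ, (∀ t : unitInterval, (t : ℝ) ≤ ζ → ∀ y ∈ Q.side 3, ∀ p : Path (Q' (1, t)) y,
            range p ⊆ Q.carrier → Q.sideDist 1 / 4 ≤ Metric.diam (range p)) ∧
          (∀ t : unitInterval, ζ ≤ (t : ℝ) → ∀ y ∈ Q.side 1, ∀ p : Path (Q' (1, t)) y,
            range p ⊆ Q.carrier → Q.sideDist 1 / 4 ≤ Metric.diam (range p))) →
        ∀ η : ℝ, 0 < η → η < ρ →
          (bondPercolation (zdGraph 2) half).real
              (symmDiff {ω | Q ∈ z2QuadConfig D (η * Real.sqrt 2) ω}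
                {ω | Q' ∈ z2QuadConfig D (η * Real.sqrt 2) ω}) ≤
            2 * ((C * K * ρ) / Q.sideDist 1) ^ α *
              (bondPercolation (zdGraph 2) half).real {ω | Q' ∈ z2QuadConfig D (η * Real.sqrt 2) ω} := by
  obtain ⟨α, c₀, hα, hc₀, hRSW⟩ := annulusDualCrossing_half_le_holds
  set C₁ : ℝ := 11 + 2 * c₀ with hC₁
  have hC₁pos : 0 < C₁ := by rw [hC₁]; linarith
  refine ⟨α, 32 * C₁, 1 / (64 * (C₁ + 1)), hα, by positivity, by positivity, ?_⟩
  intro D Q Q' ρ K hρ hK hρc hρ0 h2 htame harc hstar hcut η hη hηρ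
  have h2' := h2
  obtain ⟨hcar, h0, h1, h3, hjoin⟩ := h2
  set d₁ := Q.sideDist 1 with hd₁
  have hd₁pos : 0 < d₁ := Q.sideDist_pos 1
  have hKpos : 0 < K := by linarith
  have hKρ : ρ ≤ K * ρ := by nlinarith
  -- the regime
  have hρd : 64 * (C₁ + 1) * (K * ρ) ≤ d₁ := by
    have := hρc
    rw [div_mul_eq_mul_div, one_mul, le_div_iff₀ (by positivity)] at this
    linarith
  -- the frame (mesh `δ' = η √2`)
  have hsqrt2 : Real.sqrt 2 < 2 := by
    rw [show (2 : ℝ) = Real.sqrt 4 by rw [show (4 : ℝ) = 2 ^ 2 by norm_num, Real.sqrt_sq (by norm_num)]]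
    exact Real.sqrt_lt_sqrt (by norm_num) (by norm_num)
  obtain ⟨Φ, hΦ, hΦδ, hΦa, hΦb, hΦc, hΦd, hG⟩ :=
    Q'.exists_frame_charts' (mul_pos hη (Real.sqrt_pos.2 (by norm_num)) : 0 < η * Real.sqrt 2)
  have hδ'pos : 0 < Φ.δ := Φ.hδ
  have hδ'ρ : Φ.δ < 2 * ρ := by
    rw [hΦδ]
    calc η * Real.sqrt 2 < ρ * 2 := mul_lt_mul'' hηρ hsqrt2 hη.le (Real.sqrt_nonneg _)
      _ = 2 * ρ := by ring
  have htame' : ∀ a b : Site 2, (zdGraph 2).Adj a b →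
      IsPreconnected (segment ℝ (meshPoint Φ.δ a) (meshPoint Φ.δ b) ∩ Q.carrier) := by
    rw [hΦδ]; exact htame η hη hηρ
  have hΦT : Φ.flipFrame.Charts Q'.flip := SSContinuity.Frame.Charts.flipFrame Φ hΦ
  have hGT := Φ.flipFrame_chart (Q' := Q') hG
  -- Step 1: the discrete events
  rw [← hΦδ]
  set μ := bondPercolation (zdGraph 2) half with hμ
  set A : Set (BondConfig (Site 2)) := {ω | Q ∈ z2QuadConfig D Φ.δ ω} with hA
  set B : Set (BondConfig (Site 2)) := {ω | Q' ∈ z2QuadConfig D Φ.δ ω} with hB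
  set Bx : Set (BondConfig (Site 2)) := {ω | ∃ K', Q'.IsCrossing K' ∧ K' ⊆ openEdgeUnion Φ.δ ω}
    with hBx
  have hBBx : B = Bx := by
    ext ω; rw [hB, mem_setOf_eq, mem_z2QuadConfig_iff_exists_isCrossing hδ'pos]; rfl
  have hAx : A = {ω | ∃ K, Q.IsCrossing K ∧ K ⊆ openEdgeUnion Φ.δ ω} := by
    ext ω; rw [hA, mem_setOf_eq, mem_z2QuadConfig_iff_exists_isCrossing hδ'pos]; rfl
  have hAB : A ⊆ B := fun ω hω => by
    rw [hAx] at hω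
    obtain ⟨K₀, hK₀, hK₀O⟩ := hω
    rw [hBBx]
    exact Quad.exists_isCrossing_subquad_of_isCrossing hcar h0 h1 h3 hδ'pos hK₀ hK₀O
  -- the two events
  set c₃ : ℝ := d₁ / 4 with hc₃
  set Ea : Set (BondConfig (Site 2)) := {ω | (∃ K', Q'.IsCrossing K' ∧ K' ⊆ openEdgeUnion Φ.δ ω) ∧
      (¬ ∃ K, Q.IsCrossing K ∧ K ⊆ openEdgeUnion Φ.δ ω) ∧
      ∀ t ∈ Q.side 3, ∀ p : Path (Φ.G (Φ.wallPt ω)) t, range p ⊆ Q.carrier →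
        c₃ ≤ Metric.diam (range p)} with hEa
  set Eb : Set (BondConfig (Site 2)) := {ω | (∃ K', Q'.flip.IsCrossing K' ∧
      K' ⊆ openEdgeUnion Φ.flipFrame.δ ω) ∧
      (¬ ∃ K, Q.flip.IsCrossing K ∧ K ⊆ openEdgeUnion Φ.flipFrame.δ ω) ∧
      ∀ t ∈ Q.flip.side 3, ∀ p : Path (Φ.flipFrame.G (Φ.flipFrame.wallPt ω)) t,
        range p ⊆ Q.flip.carrier → c₃ ≤ Metric.diam (range p)} with hEb
  -- Step 2: the dichotomy `B ∖ A ⊆ Ea ∪ Eb` (no inversion + the cut)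
  obtain ⟨ζ, hcut₃, hcut₁⟩ := hcut
  have hsplit : symmDiff A B ⊆ Ea ∪ Eb := by
    intro ω hω
    have hωB : ω ∈ B := by
      rcases (Set.mem_symmDiff).1 hω with ⟨hωA, -⟩ | ⟨hωB, -⟩
      · exact hAB hωA
      · exact hωB
    have hωA : ω ∉ A := by
      rcases (Set.mem_symmDiff).1 hω with ⟨-, hnB⟩ | ⟨-, hnA⟩
      · exact absurd hωB hnB
      · exact hnA
    rw [hBBx] at hωB
    rw [hAx] at hωA
    obtain ⟨K', hK', hK'O⟩ := hωB
    have hcr : Φ.Crossed Φ.b ω := hΦ.crossed hK' hK'O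
    have hK'T : Q'.flip.IsCrossing K' := (Quad.flip_isCrossing_iff Q' K').2 hK'
    have hcrT : Φ.flipFrame.Crossed Φ.flipFrame.b ω := hΦT.crossed hK'T hK'O
    -- access paths at the two landing points, and no inversion
    have hx2 : Φ.G (Φ.wallPt ω) ∈ Q'.side 2 := hΦ.image_wallPt_mem_side_two hcr
    have hx2T : Φ.flipFrame.G (Φ.flipFrame.wallPt ω) ∈ Q'.side 2 := by
      have := hΦT.image_wallPt_mem_side_two hcrT
      rwa [Quad.flip_side_two] at this
    have acc₁ := hΦ.exists_access hcr (hstar _ hx2)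
    have acc₃ := hΦT.exists_access hcrT (by
      obtain ⟨r, hr, h⟩ := hstar _ hx2T
      exact ⟨r, hr, fun u hu hub => by rw [Quad.flip_carrier] at hu ⊢; exact h u hu hub⟩)
    have hsum := Φ.wallTop_add_wallTop_le hcr acc₁ acc₃
    -- the two landing parameters
    have hT : Φ.wallTop ω ∈ Icc (-1 : ℝ) 1 := by
      have := (Φ.wallPt_mem_rect hcr).2
      simpa [hΦc, hΦd] using this
    have hTT : Φ.flipFrame.wallTop ω ∈ Icc (-1 : ℝ) 1 := by
      have := (Φ.flipFrame.wallPt_mem_rect hcrT).2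
      simpa [hΦc, hΦd] using this
    set tlow : unitInterval := ⟨(Φ.wallTop ω + 1) / 2, ⟨by linarith [hT.1], by linarith [hT.2]⟩⟩
      with htlow
    set tup : unitInterval := ⟨(Φ.flipFrame.wallTop ω + 1) / 2,
      ⟨by linarith [hTT.1], by linarith [hTT.2]⟩⟩ with htup
    have hxlow : Φ.G (Φ.wallPt ω) = Q' (1, tlow) := by
      rw [← hG tlow]
      congr 1
      apply Complex.ext
      · simp [hΦb]
      · simp [htlow]; ring
    have hxup : Φ.flipFrame.G (Φ.flipFrame.wallPt ω) = Q' (1, unitInterval.symm tup) := by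
      rw [← Quad.flip_apply_one, ← hGT tup]
      congr 1
      apply Complex.ext
      · simp [hΦb]
      · simp [htup]; ring
    by_cases hlow : (tlow : ℝ) ≤ ζ
    · left
      refine ⟨⟨K', hK', hK'O⟩, hωA, fun t ht p hp => ?_⟩
      have := hcut₃ tlow hlow t ht (p.cast hxlow.symm rfl) (by rw [Path.cast_coe]; exact hp)
      rwa [Path.cast_coe] at this
    · right
      push Not at hlow
      have hup : ζ ≤ (unitInterval.symm tup : ℝ) := by
        rw [unitInterval.coe_symm_eq]
        have : (tlow : ℝ) ≤ 1 - (tup : ℝ) := by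
          simp only [htlow, htup]; linarith
        linarith
      refine ⟨⟨K', hK'T, hK'O⟩, ?_, fun t ht p hp => ?_⟩
      · rintro ⟨K₀, hK₀, hK₀O⟩
        exact hωA ⟨K₀, (Quad.flip_isCrossing_iff Q K₀).1 hK₀, hK₀O⟩
      · rw [Quad.flip_side_three] at ht
        rw [Quad.flip_carrier] at hp
        have := hcut₁ _ hup t ht (p.cast hxup.symm rfl) (by rw [Path.cast_coe]; exact hp)
        rwa [Path.cast_coe] at this
  -- Step 3: the radii and the RSW bound
  set r : ℝ := max (K * ρ + 5 * Φ.δ) (c₀ * Φ.δ) with hr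
  set R : ℝ := c₃ / 2 - 2 * Φ.δ with hR
  have hrle : r ≤ C₁ * (K * ρ) := by
    rw [hr, max_le_iff, hC₁]
    constructor
    · nlinarith
    · nlinarith [hc₀]
  have hr0 : 0 < r := lt_of_lt_of_le (by positivity) (le_max_left _ _)
  have hRge : d₁ / 16 ≤ R := by rw [hR, hc₃]; nlinarith [hC₁pos]
  have hrc : K * ρ + 5 * Φ.δ ≤ c₃ / 2 := by rw [hc₃]; nlinarith [hC₁pos]
  have h2r : 2 * r ≤ R := by nlinarith [hC₁pos]
  set ηb : ℝ := (r / R) ^ α with hηb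
  have hηb0 : 0 ≤ ηb := Real.rpow_nonneg (div_nonneg hr0.le (by linarith)) _
  have hRSW' : ∀ x : ℂ, μ.real (annulusDualCrossing x Φ.δ r (c₃ / 2 - 2 * Φ.δ)) ≤ ηb := fun x =>
    hRSW x Φ.δ r R hδ'pos (le_max_right _ _) h2r
  -- Step 4: the two decoupling bounds (product form)
  have hEa : μ.real Ea ≤ ηb * μ.real B := by
    have := SSContinuity.Frame.Charts.measureReal_crossed_not_crossed_far_le hΦ hΦb hΦc hΦd hG hcar
      h0 h1 hρ hρ0 hjoin htame' hK harc (le_max_left _ _) hrc hηb0 hRSW'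
    rw [hBBx]
    exact this
  have hEb : μ.real Eb ≤ ηb * μ.real B := by
    obtain ⟨-, -, -, -, hjoinT⟩ := Quad.IsPerturbationTwo.flip h2'
    have hcarT : Q'.flip.carrier ⊆ Q.flip.carrier := by simpa using hcar
    have h0T : Q'.flip.side 0 = Q.flip.side 0 := by simpa using h0
    have h1T : Q'.flip.side 1 ⊆ Q.flip.side 1 := by simpa using h3
    have hρ0T : ρ < Q.flip.sideDist 0 := by rwa [Quad.flip_sideDist_zero]
    have htameT : ∀ a b : Site 2, (zdGraph 2).Adj a b →
        IsPreconnected (segment ℝ (meshPoint Φ.flipFrame.δ a) (meshPoint Φ.flipFrame.δ b) ∩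
          Q.flip.carrier) := by
      rw [Quad.flip_carrier]; exact htame'
    have := SSContinuity.Frame.Charts.measureReal_crossed_not_crossed_far_le hΦT
      (by simp [hΦb]) (by simp [hΦd]) (by simp [hΦc]) hGT hcarT h0T h1T hρ hρ0T hjoinT htameT hK
      (Quad.flip_arc harc) (le_max_left _ _) hrc hηb0 hRSW'
    have hBT : {ω | ∃ K', Q'.flip.IsCrossing K' ∧ K' ⊆ openEdgeUnion Φ.flipFrame.δ ω} = B := by
      rw [hBBx]
      ext ω
      simp only [mem_setOf_eq]
      constructor
      · rintro ⟨K', hK', hK'O⟩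
        exact ⟨K', (Quad.flip_isCrossing_iff Q' K').1 hK', hK'O⟩
      · rintro ⟨K', hK', hK'O⟩
        exact ⟨K', (Quad.flip_isCrossing_iff Q' K').2 hK', hK'O⟩
    rw [hBT] at this
    exact this
  -- Step 5: assemble
  have hmono : μ.real (symmDiff A B) ≤ μ.real (Ea ∪ Eb) :=
    measureReal_mono hsplit (measure_ne_top _ _)
  refine hmono.trans ((measureReal_union_le Ea Eb).trans ?_)
  have hbase : r / R ≤ 32 * C₁ * K * ρ / d₁ := by
    rw [div_le_div_iff₀ (by linarith) hd₁pos]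
    calc r * d₁ ≤ C₁ * (K * ρ) * d₁ := by nlinarith
      _ = 32 * C₁ * K * ρ * (d₁ / 32) := by ring
      _ ≤ 32 * C₁ * K * ρ * R := by
          apply mul_le_mul_of_nonneg_left (by linarith) (by positivity)
  have hpow : ηb ≤ (32 * C₁ * K * ρ / d₁) ^ α :=
    Real.rpow_le_rpow (div_nonneg hr0.le (by linarith)) hbase hα.le
  have hB0 : 0 ≤ μ.real B := measureReal_nonneg
  have : ηb * μ.real B ≤ (32 * C₁ * K * ρ / d₁) ^ α * μ.real B :=
    mul_le_mul_of_nonneg_right hpow hB0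
  linarith

/-- **Schramm–Smirnov Lemma 6.1, case (2), sub-case `d = d₁`, tame quads** (see the module
docstring): `μ_η(⊞_Q Δ ⊞_{Q'}) ≤ 2 (C K ρ / d₁(Q))^α` for the quad-crossing laws `μ_η`, from the
product form and `P(⊞_{Q'}) ≤ 1`. [cite: SchrammSmirnov2011, Lemma 6.1 (2) and its proof, pp. 21–23] -/
theorem real_symmDiff_crossedEvent_le_of_isPerturbationTwo_of_tame :
    ∃ α C c : ℝ, 0 < α ∧ 0 < C ∧ 0 < c ∧
      ∀ (D : Set ℂ) (Q Q' : Quad D) (ρ K : ℝ), 0 < ρ → 1 ≤ K → K * ρ ≤ c * Q.sideDist 1 →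
        ρ < Q.sideDist 0 → Q.IsPerturbationTwo Q' ρ →
        (∀ η : ℝ, 0 < η → η < ρ → ∀ a b : Site 2, (zdGraph 2).Adj a b →
          IsPreconnected (segment ℝ (meshPoint (η * Real.sqrt 2) a) (meshPoint (η * Real.sqrt 2) b) ∩
            Q.carrier)) →
        (∀ s t : unitInterval, dist (Q' (1, s)) (Q' (1, t)) ≤ ρ → ∀ u : unitInterval,
          ((s : ℝ) ≤ u ∧ (u : ℝ) ≤ t ∨ (t : ℝ) ≤ u ∧ (u : ℝ) ≤ s) →
            dist (Q' (1, u)) (Q' (1, s)) ≤ K * ρ) →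
        (∀ x ∈ Q'.side 2, ∃ r > 0, ∀ u ∈ Q'.carrier, u ∈ ball x r → segment ℝ x u ⊆ Q'.carrier) →
        (∃ ζ : ℝ, (∀ t : unitInterval, (t : ℝ) ≤ ζ → ∀ y ∈ Q.side 3, ∀ p : Path (Q' (1, t)) y,
            range p ⊆ Q.carrier → Q.sideDist 1 / 4 ≤ Metric.diam (range p)) ∧
          (∀ t : unitInterval, ζ ≤ (t : ℝ) → ∀ y ∈ Q.side 1, ∀ p : Path (Q' (1, t)) y,
            range p ⊆ Q.carrier → Q.sideDist 1 / 4 ≤ Metric.diam (range p))) →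
        ∀ η : ℝ, 0 < η → η < ρ →
          (squareCrossingLaw D η : Measure (QuadConfig D)).real
              (symmDiff (QuadConfig.crossedEvent Q) (QuadConfig.crossedEvent Q')) ≤
            2 * ((C * K * ρ) / Q.sideDist 1) ^ α := by
  obtain ⟨α, C, c, hα, hC, hc, h⟩ := measureReal_symmDiff_le_mul_of_isPerturbationTwo_of_tame
  refine ⟨α, C, c, hα, hC, hc, ?_⟩
  intro D Q Q' ρ K hρ hK hρc hρ0 h2 htame harc hstar hcut η hη hηρ
  have hmain := h D Q Q' ρ K hρ hK hρc hρ0 h2 htame harc hstar hcut η hη hηρ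
  refine (real_squareCrossingLaw_symmDiff_le D η Q Q').trans (hmain.trans ?_)
  have hpow : 0 ≤ 2 * ((C * K * ρ) / Q.sideDist 1) ^ α := by
    have : 0 ≤ ((C * K * ρ) / Q.sideDist 1) ^ α :=
      Real.rpow_nonneg (div_nonneg (by positivity) (Q.sideDist_nonneg 1)) _
    linarith
  calc 2 * ((C * K * ρ) / Q.sideDist 1) ^ α *
        (bondPercolation (zdGraph 2) half).real {ω | Q' ∈ z2QuadConfig D (η * Real.sqrt 2) ω}
      ≤ 2 * ((C * K * ρ) / Q.sideDist 1) ^ α * 1 := by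
        gcongr; exact measureReal_le_one
    _ = 2 * ((C * K * ρ) / Q.sideDist 1) ^ α := mul_one _

end QuadCrossing

end Literature.Probability.Percolation

end
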